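import Mathlib
import Literature.Analysis.FluidPDE.LeraySelfSimilarCalculus
import Literature.Analysis.FluidPDE.SpaceTimeRescaling
import Summits.NavierStokesRegularity.OSWSelfSimilar.TypeIIModulationDictionary
import HarnessLib
/-!
# The MODULATION DICTIONARY, IV: the divergent clock and the local-energy scaling identities
# (zone Z1 TEMPLATE §T1.2 (N1) «⇒» half, §T1.4 (C1)/(C3)/(C10)/(C11) dictionary lines — kernel-checked)

HONEST FRAMING (cell ns-blowup GROUP B, zone Z1; D-0035/D-0074): part IV of the Z1 dictionary (parts I–III:
`TypeIIModulationDictionary`, `TypeIIModulationLawClasses`, `TypeIIModulatedAnsatz`). One-variable / change-of-variables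
calculus only; **nothing here is a statement about Navier–Stokes** (no solution, profile, blow-up or regularity claim; the
fields `V` below are ARBITRARY). «violates: n/a — dictionary»; bears_on LADDER-NS N5/Z1 → N1 linear core / N0⁻.

* (N1) «finite-time blow-up ⇔ ∫^∞ λ² < ∞», the ⇒ half (profile-refuter K-note 2, STATUS l.5677): for a continuous scale,
  if `λ²` is NOT integrable on `(τ₀, ∞)` the physical clock `t(τ) = t₀ + ∫_{τ₀}^τ λ²` tends to `+∞` — no finite singular
  time (`tendsto_physicalClock_atTop_of_not_integrableOn`; the ⇐ half is part I's `tendsto_physicalClock`).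
* (C10)/(C1)/(C3)/(C11) in the symmetric class `x* ≡ 0` on `ℝ³`, at a frozen time with scale `λ > 0`
  (`u = λ⁻¹ V(λ⁻¹ ·)`): `∫_{B_ρ} ‖u‖² = λ ∫_{B_{ρ/λ}} ‖V‖²` (`setIntegral_ball_normSq_modulated`, TEMPLATE (C10) «exact»);
  the Seregin scaled energy `ρ⁻¹∫_{B_ρ}‖u‖² = (ρ/λ)⁻¹ ∫_{B_{ρ/λ}}‖V‖²` (`scaledEnergy_modulated`, TEMPLATE (C1) dictionary
  `𝒜_V(R, τ)`); scale invariance of the local `L³` norm `∫_{B_ρ}‖u‖³ = ∫_{B_{ρ/λ}}‖V‖³` (`setIntegral_ball_normCube_modulated`,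
  TEMPLATE (C3)); and the dissipation `∫_{B_ρ} |∇u|²_F = λ⁻¹ ∫_{B_{ρ/λ}} |∇V|²_F` (`setIntegral_ball_gradSq_modulated`,
  TEMPLATE (C11) «‖∇u(t)‖²_{L²(B_ρ)} = λ⁻¹ ∫_{B_{ρ/λ}} |∇V|²»), via Mathlib's `Measure.setIntegral_comp_smul_of_pos` and the
  tree's `fderiv_smul_comp_smul` / `frobeniusNormSq_smul`.

WHAT IS NOT HERE: the general centre `x*(t)` (a translation; routine), the energy INEQUALITY itself, any solution.
Author: ns-blowup-profile-eng-1 g4, 2026-08-26.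
-/

open Real Filter Topology Set MeasureTheory intervalIntegral InnerProductSpace
open scoped Pointwise
open Literature.Analysis.FluidPDE

namespace Summit.NavierStokesRegularity.OSWSelfSimilar
namespace TypeIIModulationDictionary

/-! ## (N1), the divergent half of the clock dichotomy -/

/-- **(N1) ⇒.** For a continuous scale `λ`, if `λ²` is NOT integrable on `(τ₀, ∞)` then the physical clock
`t(τ) = t₀ + ∫_{τ₀}^τ λ(σ)² dσ` tends to `+∞` as `τ → ∞`: the ansatz reaches no finite singular time («infinite-time
collapse», TEMPLATE (N3) row 2). With part I's `tendsto_physicalClock` this is the template's «finite-time blow-up ⇔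
∫^∞ λ² < ∞». [new here — dictionary] -/
theorem tendsto_physicalClock_atTop_of_not_integrableOn {lam : ℝ → ℝ} (hlam : Continuous lam) (t0 τ0 : ℝ)
    (hint : ¬ IntegrableOn (fun s => lam s ^ 2) (Ioi τ0)) :
    Tendsto (fun σ => t0 + ∫ s in τ0..σ, lam s ^ 2) atTop atTop := by
  have hcont : Continuous fun s => lam s ^ 2 := hlam.pow 2
  have hii : ∀ a b : ℝ, IntervalIntegrable (fun s => lam s ^ 2) volume a b :=
    fun a b => hcont.intervalIntegrable a b
  -- the clock is monotone (nonnegative integrand)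
  have hmono : Monotone fun σ => t0 + ∫ s in τ0..σ, lam s ^ 2 := by
    intro σ₁ σ₂ hσ
    have hsub : (∫ s in τ0..σ₂, lam s ^ 2) - ∫ s in τ0..σ₁, lam s ^ 2 = ∫ s in σ₁..σ₂, lam s ^ 2 :=
      integral_interval_sub_left (hii τ0 σ₂) (hii τ0 σ₁)
    have hnn : 0 ≤ ∫ s in σ₁..σ₂, lam s ^ 2 :=
      intervalIntegral.integral_nonneg hσ fun s _ => sq_nonneg (lam s)
    simp only [add_le_add_iff_left]
    linarith
  refine tendsto_atTop_atTop_of_monotone hmono ?_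
  -- and unbounded, otherwise `λ²` would be integrable on `(τ₀, ∞)`
  by_contra hbdd
  simp only [not_forall, not_exists, not_le] at hbdd
  obtain ⟨b, hb⟩ := hbdd
  apply hint
  refine integrableOn_Ioi_of_intervalIntegral_norm_bounded (I := b - t0) (a := τ0) (b := id) (l := atTop)
    (fun i => (hcont.integrableOn_Icc).mono_set Ioc_subset_Icc_self) tendsto_id ?_
  filter_upwards [Filter.eventually_ge_atTop τ0] with i hi
  have hnorm : (∫ x in τ0..id i, ‖lam x ^ 2‖) = ∫ x in τ0..i, lam x ^ 2 := by
    refine intervalIntegral.integral_congr fun x _ => ?_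
    simp only [Real.norm_eq_abs, abs_pow, sq_abs]
  rw [hnorm]
  have := hb i
  linarith

/-! ## (C10)/(C1)/(C3)/(C11): local energies of `u = λ⁻¹ V(λ⁻¹ ·)` on balls about the centre -/

/-- Scaling of a ball about the origin in `ℝ³`: `λ⁻¹ • B(0, ρ) = B(0, ρ/λ)` for `λ > 0`. [new here — dictionary] -/
theorem inv_smul_ball_zero {lam : ℝ} (hlam : 0 < lam) (ρ : ℝ) :
    lam⁻¹ • Metric.ball (0 : EuclideanSpace ℝ (Fin 3)) ρ = Metric.ball 0 (ρ / lam) := by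
  rw [smul_ball (inv_ne_zero hlam.ne') (0 : EuclideanSpace ℝ (Fin 3)) ρ, smul_zero, Real.norm_eq_abs,
    abs_of_pos (inv_pos.mpr hlam), div_eq_inv_mul]

/-- The change of variables behind every line below: for `λ > 0` and any `g : ℝ³ → ℝ`,
`∫_{B(0,ρ)} g(λ⁻¹ x) dx = λ³ ∫_{B(0,ρ/λ)} g(y) dy`. [new here — dictionary] -/
theorem setIntegral_ball_comp_inv_smul {lam : ℝ} (hlam : 0 < lam) (ρ : ℝ) (g : EuclideanSpace ℝ (Fin 3) → ℝ) :
    ∫ x in Metric.ball (0 : EuclideanSpace ℝ (Fin 3)) ρ, g (lam⁻¹ • x)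
      = lam ^ 3 * ∫ y in Metric.ball (0 : EuclideanSpace ℝ (Fin 3)) (ρ / lam), g y := by
  rw [Measure.setIntegral_comp_smul_of_pos volume g (Metric.ball 0 ρ) (inv_pos.mpr hlam),
    inv_smul_ball_zero hlam, finrank_euclideanSpace_fin, smul_eq_mul, inv_pow, inv_inv]

/-- **TEMPLATE (C10), exact.** For `λ > 0` and any `V : ℝ³ → ℝ³`: `∫_{B_ρ} ‖λ⁻¹V(λ⁻¹x)‖² dx = λ ∫_{B_{ρ/λ}} ‖V(y)‖² dy`
— the physical local energy at scale `ρ` is `λ` times the profile's energy on the rescaled ball. [new here — dictionary] -/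
theorem setIntegral_ball_normSq_modulated {lam : ℝ} (hlam : 0 < lam) (ρ : ℝ)
    (V : EuclideanSpace ℝ (Fin 3) → EuclideanSpace ℝ (Fin 3)) :
    ∫ x in Metric.ball (0 : EuclideanSpace ℝ (Fin 3)) ρ, ‖lam⁻¹ • V (lam⁻¹ • x)‖ ^ 2
      = lam * ∫ y in Metric.ball (0 : EuclideanSpace ℝ (Fin 3)) (ρ / lam), ‖V y‖ ^ 2 := by
  have h1 : (fun x : EuclideanSpace ℝ (Fin 3) => ‖lam⁻¹ • V (lam⁻¹ • x)‖ ^ 2)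
      = fun x => lam⁻¹ ^ 2 * (fun y => ‖V y‖ ^ 2) (lam⁻¹ • x) := by
    funext x
    rw [norm_smul, mul_pow, Real.norm_eq_abs, abs_of_pos (inv_pos.mpr hlam)]
  rw [h1, MeasureTheory.integral_const_mul, setIntegral_ball_comp_inv_smul hlam ρ (fun y => ‖V y‖ ^ 2)]
  field_simp

/-- **TEMPLATE (C1) dictionary** (Seregin's scaled energy `A`): `ρ⁻¹∫_{B_ρ}‖u‖² = R⁻¹∫_{B_R}‖V‖²` with `R = ρ/λ`
(`λ, ρ > 0`) — the reading `𝒜_V(R, τ)` of the T3 tables. [new here — dictionary] -/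
theorem scaledEnergy_modulated {lam ρ : ℝ} (hlam : 0 < lam) (hρ : 0 < ρ)
    (V : EuclideanSpace ℝ (Fin 3) → EuclideanSpace ℝ (Fin 3)) :
    ρ⁻¹ * ∫ x in Metric.ball (0 : EuclideanSpace ℝ (Fin 3)) ρ, ‖lam⁻¹ • V (lam⁻¹ • x)‖ ^ 2
      = (ρ / lam)⁻¹ * ∫ y in Metric.ball (0 : EuclideanSpace ℝ (Fin 3)) (ρ / lam), ‖V y‖ ^ 2 := by
  rw [setIntegral_ball_normSq_modulated hlam ρ V]
  field_simp

/-- **TEMPLATE (C3), scale invariance of the local `L³` norm**: `∫_{B_ρ}‖λ⁻¹V(λ⁻¹x)‖³ dx = ∫_{B_{ρ/λ}}‖V‖³` (`λ > 0`).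
[new here — dictionary] -/
theorem setIntegral_ball_normCube_modulated {lam : ℝ} (hlam : 0 < lam) (ρ : ℝ)
    (V : EuclideanSpace ℝ (Fin 3) → EuclideanSpace ℝ (Fin 3)) :
    ∫ x in Metric.ball (0 : EuclideanSpace ℝ (Fin 3)) ρ, ‖lam⁻¹ • V (lam⁻¹ • x)‖ ^ 3
      = ∫ y in Metric.ball (0 : EuclideanSpace ℝ (Fin 3)) (ρ / lam), ‖V y‖ ^ 3 := by
  have h1 : (fun x : EuclideanSpace ℝ (Fin 3) => ‖lam⁻¹ • V (lam⁻¹ • x)‖ ^ 3)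
      = fun x => lam⁻¹ ^ 3 * (fun y => ‖V y‖ ^ 3) (lam⁻¹ • x) := by
    funext x
    rw [norm_smul, mul_pow, Real.norm_eq_abs, abs_of_pos (inv_pos.mpr hlam)]
  rw [h1, MeasureTheory.integral_const_mul, setIntegral_ball_comp_inv_smul hlam ρ (fun y => ‖V y‖ ^ 3)]
  field_simp

/-- **TEMPLATE (C11), the dissipation dictionary**: with `|·|_F²` the Frobenius norm of the derivative
(`Literature.Analysis.FluidPDE.frobeniusNormSq`), `∫_{B_ρ} |∇(λ⁻¹V(λ⁻¹·))|_F² dx = λ⁻¹ ∫_{B_{ρ/λ}} |∇V|_F² dy` for `λ > 0`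
and any `V : ℝ³ → ℝ³` (no differentiability needed: both sides use `fderiv`'s junk value consistently, by the tree's
`fderiv_smul_comp_smul`). [new here — dictionary] -/
theorem setIntegral_ball_gradSq_modulated {lam : ℝ} (hlam : 0 < lam) (ρ : ℝ)
    (V : EuclideanSpace ℝ (Fin 3) → EuclideanSpace ℝ (Fin 3)) :
    ∫ x in Metric.ball (0 : EuclideanSpace ℝ (Fin 3)) ρ, frobeniusNormSq (fderiv ℝ (fun z => lam⁻¹ • V (lam⁻¹ • z)) x)
      = lam⁻¹ * ∫ y in Metric.ball (0 : EuclideanSpace ℝ (Fin 3)) (ρ / lam), frobeniusNormSq (fderiv ℝ V y) := by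
  have h1 : (fun x : EuclideanSpace ℝ (Fin 3) => frobeniusNormSq (fderiv ℝ (fun z => lam⁻¹ • V (lam⁻¹ • z)) x))
      = fun x => (lam⁻¹ ^ 2) ^ 2 * (fun y => frobeniusNormSq (fderiv ℝ V y)) (lam⁻¹ • x) := by
    funext x
    rw [fderiv_smul_comp_smul V lam⁻¹ x, frobeniusNormSq_smul]
  rw [h1, MeasureTheory.integral_const_mul, setIntegral_ball_comp_inv_smul hlam ρ (fun y => frobeniusNormSq (fderiv ℝ V y))]
  field_simp

end TypeIIModulationDictionary
end Summit.NavierStokesRegularity.OSWSelfSimilar
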